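import Literature.AlgebraicGeometry.AbelianSchemes.AbelianSchemeLDeltaOfLambda
import Literature.AlgebraicGeometry.AbelianVarieties.SymmetricDivisorClassPullback
import Literature.AlgebraicGeometry.AbelianVarieties.LineBundleTensorPower
import Literature.AlgebraicGeometry.AbelianVarieties.HomogeneousLineBundleDivisor
import Literature.AlgebraicGeometry.Motives.AbelianVarietyCubeProofs
import Literature.AlgebraicGeometry.Modules.CohomologyFlatBaseChange
import Literature.AlgebraicGeometry.AbelianVarieties.SymmetricAmpleExtOneVanishing
import Mathlib.FieldTheory.IsAlgClosed.AlgebraicClosure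
import HarnessLib

/-!
# `H¹` of the fibres of `L^Δ(λ)^{⊗m}` vanishes, for a polarised abelian scheme ([MFK94] Prop. 6.13, field case, via the
# `[n]`-trick): consumer packaging — `ι_s̄^*L^Δ(λ) = 𝒪(Θ + (−1)^*Θ)` at geometric points and `κ → κ̄` descent

Layer `Literature/AlgebraicGeometry/AbelianSchemes`, namespace `Literature.AlgebraicGeometry.AbelianSchemes(.AbelianSchemeOver)`.
THEOREMS ONLY (no definition, no named fact, no instance, no notation, no `sorry`).  Cell `hodgecm-mathlib` (D-0151), F-DAG
F-2 (b) «field case of [MumfordFogartyKirwan1994] Prop. 6.13» on the road of record «`[n]`-trick» (B-plan1 (g16) 07:21:48Z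
2026-08-30; census `B-provers/B-p05/g17/CENSUS-F2b-FieldVanishing.B-p05g17.md`): file V4 = the CONSUMER PACKAGING at the fibres
of an abelian scheme (B-p11 (g17)); the field-level brick V3 «`H¹(B, 𝒪(Θ)) = 0` for `Θ` symmetric ample on an abelian
variety `B` over a field» (B-p05 (g17), ★ V1 `Morphisms/CechModuleFiniteLocallyFreePullback` + V3a
`AbelianVarieties/SymmetricAmpleH1Vanishing` + V2 + V5) enters here as the HYPOTHESIS `hV3`, stated in V3's exact shape
`∀ B Θ, Θ.IsAmple → ((−1)^*Θ ∼ Θ) → Subsingleton (Ext¹(𝒪_B, 𝒪(Θ)))`, so that this file is unconditional and the consumer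
plugs the ★ V3 head by name (an edition 2 will add the hypothesis-free corollaries once V3 is ★).
HC_CM is proved only modulo the 7 printed citations until rung 0 closes; nothing here bears on a summit statement.

SETTING.  `A/S` an abelian scheme (★ `AbelianSchemeOver`), `D = (Â, 𝒫)` a dual pair (★ `DualPair`), `λ : A → Â` an
`S`-morphism / a polarisation `pol` (★ `Polarization`: [MFK94] Def. 6.3 — at every geometric point `λ̄ = Λ(𝒪(Θ))` for an
AMPLE `Θ`, ★ `IsLambdaOfAt`), the GLOBAL line bundle `L^Δ(λ) := Gr^*𝒫` on `A` for the graph `Gr = (1_A, λ) : A → A ×_S Â`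
(a variable with its two projections `hGr₁`, `hGr₂` — the convention of ★ `AbelianSchemeLDeltaOfLambda`), its tensor powers
`tensorPow (Gr^*𝒫) m` (★ `Modules.tensorPow`), a geometric point `s : Spec Ω → S` (`Ω` algebraically closed) with fibre
`A_s = (A.fibre s).toAbelianVariety` and fibre inclusion `j = ι_s` (`hι : j = pullback.fst`).

* §0 `Lam_id_id_eq_cechCl_add_pullback_neg` — on any abelian variety over a field: **`Λ(𝟙, 𝟙) = [Θ] + [(−1)^*Θ]`** in
  `Ȟ¹(A, 𝒪^×)` (additive classes `cechCl`; Mumford's `Λ(x, y) = [(xy)^*Θ] − [x^*Θ] − [y^*Θ]`, ★ `AbelianVariety.Lam`), i.e.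
  `[2]^*Θ − 2Θ ∼ Θ + (−1)^*Θ` — from the biadditivity of `Λ` (the cubical structure, ★ `Lam_mul_right` over ★
  `cubicalStructure_linEquiv_holds`) at `(𝟙, 𝟙, 𝟙⁻¹)`.
* §1 **`detClass_restrict_LDelta_eq_cechClass_add_pullback_neg`** — at a geometric point with `λ̄ = Λ(𝒪(Θ))`:
  **`[ι_s^*L^Δ(λ)] = [Θ + (−1)^*Θ]`** (★ `pullback_twoSlice_detClass_P_eq_mk_mumfordCocycle` — `[h^*𝒫] = [Λ(Θ)]` by the seesaw —,
  ★ `diag_comp_twoSlice`, ★ `ofMul_pullback_diag_mk_mumfordCocycle` — `Δ^*[Λ(Θ)] = Λ(𝟙, 𝟙)` —, §0).  This is MFK's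
  «`L^Δ(λ) ≅ Δ^*{μ^*L ⊗ p₁^*L⁻¹ ⊗ p₂^*L⁻¹}`» with the class made explicit and SYMMETRIC; no «`(−1 × −1)^*𝒫 ≅ 𝒫`» is needed.
* §2 **`Polarization.exists_symmetric_isAmple_iso_restrict_LDelta_tensorPow`** — for a polarisation and `m ≥ 1`:
  `ι_s^*(L^Δ(λ)^{⊗m}) ≅ 𝒪(Θ')` with `Θ' = m • (Θ + (−1)^*Θ)` AMPLE (★ `IsAmple.add`/`.pullback`/`.smul`, [GortzWedhorn2023]
  Rem. 27.185) and SYMMETRIC (`(−1)^*Θ' ∼ Θ'`, ★ `symmetric_nsmul`) — rank-one modules with equal classes are isomorphic (★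
  `nonempty_iso_iff_detClass_eq`, ★ `detClass_tensorPow`, ★ `detClass_lineBundle_toUnitCocycle`).
* §3 **`Polarization.subsingleton_ext_one_restrict_LDelta_tensorPow_of_geometric`** — `Ext¹(𝒪_{A_s}, ι_s^*L^Δ(λ)^{⊗m}) = 0`
  at a geometric point, given `hV3` over `Ω`.
* §4 HEAD **`Polarization.subsingleton_ext_one_pullback_LDelta_tensorPow (pol) (Gr) (hGr₁) (hGr₂) {κ} [Field κ] (t : Spec κ ⟶ S)
  (H : IsPullback iX f₀ A.X.hom t) (hm : 0 < m) (hV3 over κ̄) : Subsingleton (Ext.{1} (unitModule X₀) (iX^*(L^Δ(λ)^{⊗m})) 1)`** —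
  on EVERY fibre over EVERY field-valued point `t`, in ANY cartesian presentation `X₀` of the fibre (so that Mathlib's `p.fiber y`
  / `p.fiberι y` of ★ `Morphisms/SectionsBaseChangeOfFibreVanishingPoints` and the affine-chart fibre squares of the H-block of ★
  `Morphisms/ProjectiveOverBaseOfFibresEmbedding` are served alike): the geometric fibre over `κ̄ = AlgebraicClosure κ` maps to
  `X₀` by a cartesian square over `Spec κ̄ → Spec κ` (pasting, Mathlib `IsPullback.of_right`), §3 upstairs, and faithfully
  flat DESCENT of the vanishing along the field extension (★ `Modules.subsingleton_ext_unit_succ_iff_of_isPullback_specMap`,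
  [GortzWedhorn2023] Cor. 22.91).  With `m = 3` this is the `hvan` input of the (hbc)/projectivity consumers for `π_*L^Δ(λ)³`.

## References
* [MumfordFogartyKirwan1994] D. Mumford, J. Fogarty, F. Kirwan, *Geometric Invariant Theory*, 3rd ed. (1994), Ch. 6 §2:
  Definition 6.3 (p. 120), Proposition 6.10 and its proof (p. 121), Proposition 6.13 (p. 123).
* [MumfordAV1970] D. Mumford, *Abelian Varieties*, TIFR Studies in Mathematics 5 (1970), §6 Cor. 3–4 (p. 59), §8 (`Λ(L)`),
  §16 (the vanishing theorem).
* [GortzWedhorn2023] U. Görtz, T. Wedhorn, *Algebraic Geometry II: Cohomology of Schemes* (2023), Rem. 27.185 (p. 674); Cor. 22.91 (p. 278).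
* [Hartshorne1977] R. Hartshorne, *Algebraic Geometry*, GTM 52 (1977), II Ex. 6.8 (a), III Ex. 4.5.
-/

noncomputable section

set_option backward.isDefEq.respectTransparency false

open CategoryTheory CategoryTheory.Limits AlgebraicGeometry MonoidalCategory CartesianMonoidalCategory
open CategoryTheory.Abelian
open scoped MonObj

universe u

namespace Literature.AlgebraicGeometry.AbelianSchemes

open Literature.AlgebraicGeometry.Motives Literature.AlgebraicGeometry.Modules
  Literature.AlgebraicGeometry.AbelianVarieties

/-! ## §0 Two bookkeeping lemmas on an abelian variety over a field -/

section Field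

variable {K : Type u} [Field K] (B : AbelianVariety K) (Θ : CartierDivisor B.X.left)

/-- **`Λ(𝟙, 𝟙) = [Θ] + [(−1)^*Θ]`** in `Ȟ¹(A, 𝒪^×)` (additively): biadditivity of Mumford's `Λ` (the cubical structure, ★
`AbelianVariety.Lam_mul_right`) at `(𝟙, 𝟙, 𝟙⁻¹)` gives `Λ(𝟙, 𝟙) + Λ(𝟙, 𝟙⁻¹) = Λ(𝟙, e) = 0`, and
`Λ(𝟙, 𝟙⁻¹) = [e^*Θ] − [Θ] − [(−1)^*Θ] = −[Θ] − [(−1)^*Θ]` — i.e. `[2]^*Θ − 2Θ ∼ Θ + (−1)^*Θ`.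
[cite: MumfordAV1970, §6 Cor. 3 (p. 59)] [cite: GortzWedhorn2023, Prop. 27.184 (1) and Rem. 27.185 (p. 674)] -/
theorem Lam_id_id_eq_cechCl_add_pullback_neg :
    AbelianVariety.Lam Θ (cechCl B.X.left) (𝟙 B.X) (𝟙 B.X) =
      cechCl B.X.left (Θ + Θ.pullback (AbelianVariety.Hom.toSchemeHom (-𝟙 B))) := by
  have hadd := cechCl_add B.X.left
  have heq := linEquiv_iff_cechCl_eq B.X.left
  have h := AbelianVariety.Lam_mul_right (L := Θ) hadd heq B.cubicalStructure_linEquiv_holds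
    (𝟙 B.X) (𝟙 B.X) (𝟙 B.X)⁻¹
  rw [mul_inv_cancel, AbelianVariety.Lam_comm (𝟙 B.X) (1 : B.X ⟶ B.X),
    AbelianVariety.Lam_one_left heq hadd] at h
  -- `Λ(𝟙, 𝟙) = -Λ(𝟙, 𝟙⁻¹) = [𝟙^*Θ] + [(𝟙⁻¹)^*Θ]`
  have h' : AbelianVariety.Lam Θ (cechCl B.X.left) (𝟙 B.X) (𝟙 B.X) =
      AbelianVariety.lam Θ (cechCl B.X.left) (𝟙 B.X) + AbelianVariety.lam Θ (cechCl B.X.left) (𝟙 B.X)⁻¹ := by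
    have e : AbelianVariety.Lam Θ (cechCl B.X.left) (𝟙 B.X) (𝟙 B.X)⁻¹ =
        -(AbelianVariety.lam Θ (cechCl B.X.left) (𝟙 B.X) + AbelianVariety.lam Θ (cechCl B.X.left) (𝟙 B.X)⁻¹) := by
      unfold AbelianVariety.Lam
      rw [mul_inv_cancel, AbelianVariety.lam_one heq hadd]
      abel
    rw [e] at h
    exact (eq_of_sub_eq_zero (by rw [sub_eq_add_neg]; exact h.symm))
  rw [h', hadd]
  unfold AbelianVariety.lam
  have hinv : ((𝟙 B.X)⁻¹ : B.X ⟶ B.X).left = AbelianVariety.Hom.toSchemeHom (-𝟙 B) := by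
    rw [← B.zsmulPt_neg_one_eq_inv, B.zsmulPt_neg_one_left]
  congr 1
  · exact (heq _ _).1 (by rw [Over.id_left]; exact Θ.classPullback_id_linEquiv)
  · rw [CartierDivisor.classPullback_congr hinv]
    exact (heq _ _).1 (Θ.classPullback_linEquiv_pullback _)

end Field

namespace AbelianSchemeOver

/-- `(f ≫ g)^* = f^* ∘ g^*` on `Ȟ¹(-, 𝒪^×)`. [cite: Hartshorne1977, II Ex. 6.8 (a)] -/
private theorem cechPic_pullback_comp' {X Y Z : Scheme.{u}} (f : X ⟶ Y) (g : Y ⟶ Z) (c₀ : CechPic Z) :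
    CechPic.pullback (f ≫ g) c₀ = CechPic.pullback f (CechPic.pullback g c₀) :=
  CechPic.pullback_comp f g c₀

variable {S : Scheme.{u}} (A : AbelianSchemeOver S) (D : A.DualPair) {lam : A.X ⟶ D.hat.X}
  {Ω : Type u} [Field Ω] [IsAlgClosed Ω] (s : Spec (.of Ω) ⟶ S)
  {j : (A.fibre s).toAbelianVariety.X.left ⟶ A.X.left} {Θ : CartierDivisor (A.fibre s).toAbelianVariety.X.left}

/-! ## §1 The class of `ι_s^*L^Δ(λ)` at a geometric point is `[Θ + (−1)^*Θ]` -/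

/-- **`[ι_s^*L^Δ(λ)] = [Θ + (−1)^*Θ]` in `Ȟ¹(A_s, 𝒪^×)`** at a geometric point `s` with `λ̄ = Λ(𝒪(Θ))` (★ `IsLambdaOfAt`):
for the GLOBAL `L^Δ(λ) := Gr^*𝒫` (`Gr = (1_A, λ)`, a variable with its two projections) restricted along the fibre inclusion
`j = ι_s`, `[ι_s^*L^Δ(λ)] = Δ^*[Λ(Θ)]` (★ `pullback_twoSlice_detClass_P_eq_mk_mumfordCocycle`, ★ `diag_comp_twoSlice`)
`= Λ(𝟙, 𝟙)` (★ `ofMul_pullback_diag_mk_mumfordCocycle`) `= [Θ] + [(−1)^*Θ]` (§0) — MFK's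
«`L^Δ(λ) ≅ Δ^*{μ^*(L) ⊗ p₁^*(L)⁻¹ ⊗ p₂^*(L)⁻¹}`» made explicit as the SYMMETRIC class `Θ + (−1)^*Θ`.
[cite: MumfordFogartyKirwan1994, Ch. 6 §2 Prop. 6.10, proof (p. 121)] [cite: GortzWedhorn2023, Rem. 27.185 (p. 674)] -/
theorem detClass_restrict_LDelta_eq_cechClass_add_pullback_neg (hι : j = pullback.fst A.X.hom s)
    (hΛ : A.IsLambdaOfAt s D lam Θ)
    (Gr : A.X.left ⟶ A.prodLeft D.hat) (hGr₁ : Gr ≫ pullback.fst A.X.hom D.hat.X.hom = 𝟙 _)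
    (hGr₂ : Gr ≫ pullback.snd A.X.hom D.hat.X.hom = lam.left)
    (hL : IsFiniteLocallyFree ((Scheme.Modules.pullback j).obj ((Scheme.Modules.pullback Gr).obj D.P))) :
    detClass hL = (Θ + Θ.pullback (AbelianVariety.Hom.toSchemeHom (-𝟙 (A.fibre s).toAbelianVariety))).cechClass := by
  have hP : IsFiniteLocallyFree D.P := HasRank.isFiniteLocallyFree' D.hasRank_one
  have hgr₁ : (j ≫ Gr) ≫ pullback.fst A.X.hom D.hat.X.hom = j := by
    rw [Category.assoc, hGr₁, Category.comp_id]
  have hgr₂ : (j ≫ Gr) ≫ pullback.snd A.X.hom D.hat.X.hom = j ≫ lam.left := by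
    rw [Category.assoc, hGr₂]
  have e : detClass hL = CechPic.pullback (j ≫ Gr) (detClass hP) :=
    ((detClass_eq_of_iso (Iso.refl _) hL ((hP.pullback Gr).pullback j)).trans (detClass_pullback _ (hP.pullback Gr))).trans
      (((congrArg _ (detClass_pullback _ hP)).trans (cechPic_pullback_comp' j Gr (detClass hP)).symm))
  obtain ⟨h, hh₁, hh₂⟩ : ∃ h : ((A.fibre s).toAbelianVariety.X ⊗ (A.fibre s).toAbelianVariety.X).left ⟶ A.prodLeft D.hat,
      h ≫ pullback.fst A.X.hom D.hat.X.hom =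
        (fst (A.fibre s).toAbelianVariety.X (A.fibre s).toAbelianVariety.X).left ≫ j ∧
      h ≫ pullback.snd A.X.hom D.hat.X.hom =
        (snd (A.fibre s).toAbelianVariety.X (A.fibre s).toAbelianVariety.X).left ≫ j ≫ lam.left :=
    ⟨pullback.lift _ _ (A.fst_fibreIncl_comp_hom_eq D lam s j hι), pullback.lift_fst _ _ _, pullback.lift_snd _ _ _⟩
  rw [e, ← A.diag_comp_twoSlice D lam s h hh₁ hh₂ (j ≫ Gr) hgr₁ hgr₂, cechPic_pullback_comp' _ h (detClass hP),
    A.pullback_twoSlice_detClass_P_eq_mk_mumfordCocycle D s hι hΛ hP h hh₁ hh₂]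
  apply Additive.ofMul.injective
  rw [ofMul_pullback_diag_mk_mumfordCocycle, Lam_id_id_eq_cechCl_add_pullback_neg]

/-! ## §2 `ι_s^*L^Δ(λ)^{⊗ m} ≅ 𝒪(m • Θ_sym)` with `Θ_sym` symmetric ample, for a polarisation -/

/-- **At a geometric point, the restriction of a power of `L^Δ(λ)` is `𝒪` of a SYMMETRIC AMPLE divisor** — for a polarisation
`λ` (★ `Polarization`: `λ̄ = Λ(𝒪(Θ))` with `Θ` ample at every geometric point), `m ≥ 1`, and the fibre inclusion `j = ι_s`:
`ι_s^*(L^Δ(λ)^{⊗ m}) ≅ 𝒪(m • (Θ + (−1)^*Θ))`, and `Θ' := m • (Θ + (−1)^*Θ)` is ample (GW II Rem. 27.185: `(−1)^*Θ` is ample as a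
pull-back along an automorphism, sums and positive multiples of amples are ample) and symmetric (`(−1)^*Θ' ∼ Θ'`).
[cite: MumfordFogartyKirwan1994, Ch. 6 §2 Prop. 6.10 (p. 121) and Def. 6.3 (p. 120)] [cite: GortzWedhorn2023, Rem. 27.185 (p. 674)] -/
theorem Polarization.exists_symmetric_isAmple_iso_restrict_LDelta_tensorPow (pol : A.Polarization D)
    (hι : j = pullback.fst A.X.hom s)
    (Gr : A.X.left ⟶ A.prodLeft D.hat) (hGr₁ : Gr ≫ pullback.fst A.X.hom D.hat.X.hom = 𝟙 _)
    (hGr₂ : Gr ≫ pullback.snd A.X.hom D.hat.X.hom = pol.lam.left) {m : ℕ} (hm : 0 < m) :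
    ∃ Θ' : CartierDivisor (A.fibre s).toAbelianVariety.X.left, Θ'.IsAmple ∧
      (Θ'.pullback (AbelianVariety.Hom.toSchemeHom (-𝟙 (A.fibre s).toAbelianVariety))).LinEquiv Θ' ∧
      Nonempty ((Scheme.Modules.pullback j).obj (tensorPow ((Scheme.Modules.pullback Gr).obj D.P) m) ≅
        lineBundle Θ'.toUnitCocycle) := by
  obtain ⟨Θ, hΘ, hΛ⟩ := pol.exists_ample Ω s
  let B := (A.fibre s).toAbelianVariety
  let ν : B.X.left ⟶ B.X.left := AbelianVariety.Hom.toSchemeHom (-𝟙 B)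
  have hνν : ν ≫ ν = 𝟙 B.X.left := by
    change AbelianVariety.Hom.toSchemeHom ((-𝟙 B) ≫ (-𝟙 B)) = 𝟙 B.X.left
    rw [Preadditive.neg_comp_neg, Category.comp_id]
    rfl
  haveI : IsIso ν := ⟨ν, hνν, hνν⟩
  let Θs : CartierDivisor B.X.left := Θ + Θ.pullback ν
  -- symmetric, ample
  have hsym : (Θs.pullback ν).LinEquiv Θs := by
    refine CartierDivisor.SameDivisor.linEquiv ?_
    refine (CartierDivisor.pullback_add_sameDivisor Θ (Θ.pullback ν) ν).trans ?_
    refine CartierDivisor.SameDivisor.trans ?_ (CartierDivisor.add_comm_sameDivisor _ _)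
    refine CartierDivisor.SameDivisor.add (CartierDivisor.SameDivisor.refl _) ?_
    refine (CartierDivisor.pullback_pullback_sameDivisor Θ ν ν).trans ?_
    exact (Θ.pullback_congr_sameDivisor hνν).trans Θ.pullback_id_sameDivisor
  have hamp : Θs.IsAmple := hΘ.add (hΘ.pullback ν)
  refine ⟨m • Θs, hamp.smul hm, ?_, ?_⟩
  · -- `(−1)^*(m • Θs) ∼ m • Θs`
    rw [← (AbelianVarieties.symmetric_iff_pullback_neg_id_linEquiv (X := B) _)] at hsym ⊢
    exact AbelianVarieties.symmetric_nsmul hsym m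
  · -- classes: `[j^*(L^{⊗m})] = [j^*L]^m = [Θs]^m = [m • Θs]`
    have hLΔ₁ : HasRank ((Scheme.Modules.pullback Gr).obj D.P) 1 := hasRank_pullback Gr D.hasRank_one
    have hL : IsFiniteLocallyFree ((Scheme.Modules.pullback j).obj ((Scheme.Modules.pullback Gr).obj D.P)) :=
      (HasRank.isFiniteLocallyFree' hLΔ₁).pullback j
    have hcl := A.detClass_restrict_LDelta_eq_cechClass_add_pullback_neg D s hι hΛ Gr hGr₁ hGr₂ hL
    refine (nonempty_iso_iff_detClass_eq (hasRank_pullback j (hasRank_tensorPow_one hLΔ₁ m))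
      (m • Θs).toUnitCocycle.hasRank_lineBundle ((isFiniteLocallyFree_tensorPow
        (HasRank.isFiniteLocallyFree' hLΔ₁) m).pullback j) (m • Θs).toUnitCocycle.isFiniteLocallyFree_lineBundle).2 ?_
    have hF : IsFiniteLocallyFree ((Scheme.Modules.pullback Gr).obj D.P) := HasRank.isFiniteLocallyFree' hLΔ₁
    rw [detClass_lineBundle_toUnitCocycle, detClass_pullback _ (isFiniteLocallyFree_tensorPow hF m),
      detClass_tensorPow hLΔ₁ hF m, map_pow, ← detClass_pullback _ hF, hcl, cechClass_smul']

/-! ## §3 Vanishing of `H¹` on the geometric fibre (over the `[n]`-trick brick V3) -/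

section Vanishing

variable {S : Scheme.{0}} (A : AbelianSchemeOver S) (D : A.DualPair)

/-- `Ext`-vanishing is invariant under isomorphism of the second argument. [folklore] -/
private theorem subsingleton_ext_of_iso' {C : Type*} [Category C] [Abelian C] [HasExt.{1} C] (P : C) {Y Y' : C}
    (e : Y ≅ Y') (i : ℕ) [h : Subsingleton (Ext P Y' i)] : Subsingleton (Ext P Y i) := by
  refine subsingleton_of_forall_eq 0 fun x => ?_
  have hx : x = (x.comp (Ext.mk₀ e.hom) (add_zero i)).comp (Ext.mk₀ e.inv) (add_zero i) := by
    rw [Ext.comp_assoc_of_second_deg_zero, Ext.mk₀_comp_mk₀, e.hom_inv_id, Ext.comp_mk₀_id]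
  rw [hx, Subsingleton.elim (x.comp (Ext.mk₀ e.hom) (add_zero i)) 0, Ext.zero_comp]

/-- **`H¹(A_s̄, ι_s̄^*L^Δ(λ)^{⊗m}) = 0` at a geometric point** (`m ≥ 1`), GIVEN the field-level vanishing `H¹(B, 𝒪(Θ')) = 0` for
symmetric ample `Θ'` on abelian varieties `B` over `Ω` (the `[n]`-trick brick V3, hypothesis `hV3` in its exact shape): by §2,
`ι_s̄^*L^Δ(λ)^{⊗m} ≅ 𝒪(Θ')` with `Θ'` symmetric ample. [cite: MumfordFogartyKirwan1994, Ch. 6 §2 Prop. 6.13 (p. 123)]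
[cite: MumfordAV1970, §16 (the vanishing theorem)] -/
theorem Polarization.subsingleton_ext_one_restrict_LDelta_tensorPow_of_geometric (pol : A.Polarization D)
    (Gr : A.X.left ⟶ A.prodLeft D.hat) (hGr₁ : Gr ≫ pullback.fst A.X.hom D.hat.X.hom = 𝟙 _)
    (hGr₂ : Gr ≫ pullback.snd A.X.hom D.hat.X.hom = pol.lam.left)
    {Ω : Type} [Field Ω] [IsAlgClosed Ω] (s : Spec (.of Ω) ⟶ S)
    {j : (A.fibre s).toAbelianVariety.X.left ⟶ A.X.left} (hι : j = pullback.fst A.X.hom s) {m : ℕ} (hm : 0 < m)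
    (hV3 : ∀ (B : AbelianVariety Ω) (Θ : CartierDivisor B.X.left), Θ.IsAmple →
      (Θ.pullback (AbelianVariety.Hom.toSchemeHom (-𝟙 B))).LinEquiv Θ →
      Subsingleton (Ext.{1} (unitModule B.X.left) (lineBundle Θ.toUnitCocycle) 1)) :
    Subsingleton (Ext.{1} (unitModule (A.fibre s).toAbelianVariety.X.left)
      ((Scheme.Modules.pullback j).obj (tensorPow ((Scheme.Modules.pullback Gr).obj D.P) m)) 1) := by
  obtain ⟨Θ', hamp, hsym, ⟨e⟩⟩ := pol.exists_symmetric_isAmple_iso_restrict_LDelta_tensorPow A D s hι Gr hGr₁ hGr₂ hm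
  haveI := hV3 _ Θ' hamp hsym
  exact subsingleton_ext_of_iso' _ e 1

/-! ## §4 Descent to the fibre over ANY field-valued point, in ANY cartesian presentation -/

/-- **`H¹(X₀, L^Δ(λ)^{⊗m}|_{X₀}) = 0` on EVERY fibre of a polarised abelian scheme** (`m ≥ 1`; the consumer's `m = 3`), for
ANY field `κ`, ANY `t : Spec κ → S` and ANY cartesian square `X₀ = A ×_S Spec κ` (`H : IsPullback iX f₀ π_A t` — serves
`p.fiber y` ∕ `p.fiberι y` and affine-chart fibre squares alike), GIVEN the field-level brick V3 over `κ̄` (`hV3`): the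
geometric fibre over `κ̄ = AlgebraicClosure κ` maps to `X₀` by a cartesian square over `Spec κ̄ → Spec κ` (pasting,
`IsPullback.of_right`), §3 gives the vanishing upstairs, and faithfully flat descent along the field extension (★
`Modules.subsingleton_ext_unit_succ_iff_of_isPullback_specMap`) brings it down.  This is the `hvan` input of ★
`Morphisms/SectionsBaseChangeOfFibreVanishingPoints` ∕ ★ `Modules/PushforwardBaseChangeIsoOfFibreVanishing` and of the H-block
of ★ `Morphisms/ProjectiveOverBaseOfFibresEmbedding` at `E = L^Δ(λ)^{⊗3}`. [cite: MumfordFogartyKirwan1994, Ch. 6 §2 Prop. 6.13 (p. 123)]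
[cite: MumfordAV1970, §16 (the vanishing theorem)] [cite: GortzWedhorn2023, Cor. 22.91 (p. 278)] -/
theorem Polarization.subsingleton_ext_one_pullback_LDelta_tensorPow (pol : A.Polarization D)
    (Gr : A.X.left ⟶ A.prodLeft D.hat) (hGr₁ : Gr ≫ pullback.fst A.X.hom D.hat.X.hom = 𝟙 _)
    (hGr₂ : Gr ≫ pullback.snd A.X.hom D.hat.X.hom = pol.lam.left)
    {κ : Type} [Field κ] (t : Spec (.of κ) ⟶ S) {X₀ : Scheme.{0}} {iX : X₀ ⟶ A.X.left} {f₀ : X₀ ⟶ Spec (.of κ)}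
    (H : IsPullback iX f₀ A.X.hom t) {m : ℕ} (hm : 0 < m)
    (hV3 : ∀ (B : AbelianVariety (AlgebraicClosure κ)) (Θ : CartierDivisor B.X.left), Θ.IsAmple →
      (Θ.pullback (AbelianVariety.Hom.toSchemeHom (-𝟙 B))).LinEquiv Θ →
      Subsingleton (Ext.{1} (unitModule B.X.left) (lineBundle Θ.toUnitCocycle) 1)) :
    Subsingleton (Ext.{1} (unitModule X₀)
      ((Scheme.Modules.pullback iX).obj (tensorPow ((Scheme.Modules.pullback Gr).obj D.P) m)) 1) := by
  -- the geometric point `s̄ : Spec κ̄ → Spec κ → S` and its fibre `F = A_s̄`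
  let φ : κ →+* AlgebraicClosure κ := algebraMap κ (AlgebraicClosure κ)
  let s : Spec (.of (AlgebraicClosure κ)) ⟶ S := Spec.map (CommRingCat.ofHom φ) ≫ t
  let g' : (A.fibre s).toAbelianVariety.X.left ⟶ Spec (.of (AlgebraicClosure κ)) := pullback.snd A.X.hom s
  have hbig : IsPullback (pullback.fst A.X.hom s) g' A.X.hom (Spec.map (CommRingCat.ofHom φ) ≫ t) :=
    IsPullback.of_hasPullback A.X.hom s
  -- `k' : A_s̄ → X₀` through the given square, and the small cartesian square over `Spec κ̄ → Spec κ`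
  let k' : (A.fibre s).toAbelianVariety.X.left ⟶ X₀ :=
    H.lift (pullback.fst A.X.hom s) (g' ≫ Spec.map (CommRingCat.ofHom φ)) (by rw [Category.assoc]; exact hbig.w)
  have hk₁ : k' ≫ iX = pullback.fst A.X.hom s := H.lift_fst _ _ _
  have hk₂ : k' ≫ f₀ = g' ≫ Spec.map (CommRingCat.ofHom φ) := H.lift_snd _ _ _
  have hsq : IsPullback k' g' f₀ (Spec.map (CommRingCat.ofHom φ)) :=
    IsPullback.of_right (by rw [hk₁]; exact hbig) hk₂ H
  -- the module on `X₀` is affine-localizing; `f₀` is proper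
  let E : A.X.left.Modules := tensorPow ((Scheme.Modules.pullback Gr).obj D.P) m
  have hE : IsFiniteLocallyFree E :=
    isFiniteLocallyFree_tensorPow (HasRank.isFiniteLocallyFree' (hasRank_pullback Gr D.hasRank_one)) m
  have hG : IsAffineLocalizing ((Scheme.Modules.pullback iX).obj E) := by
    haveI := (hE.pullback iX).isVectorBundle.1
    exact IsAffineLocalizing.of_isQuasicoherent _
  haveI : IsProper A.X.hom := A.isProper
  haveI : IsProper f₀ := MorphismProperty.of_isPullback H inferInstance
  -- upstairs: §3 with `j := k' ≫ iX = ι_s̄`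
  have hup : Subsingleton (Ext.{1} (unitModule (A.fibre s).toAbelianVariety.X.left)
      ((Scheme.Modules.pullback k').obj ((Scheme.Modules.pullback iX).obj E)) 1) := by
    haveI := pol.subsingleton_ext_one_restrict_LDelta_tensorPow_of_geometric A D Gr hGr₁ hGr₂ s hk₁ hm hV3
    exact subsingleton_ext_of_iso' (unitModule (A.fibre s).toAbelianVariety.X.left)
      ((Scheme.Modules.pullbackComp k' iX).app E) 1
  -- downstairs by faithfully flat descent along `κ → κ̄`
  exact (subsingleton_ext_unit_succ_iff_of_isPullback_specMap φ hsq ((Scheme.Modules.pullback iX).obj E) hG 0).1 hup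

end Vanishing

end AbelianSchemeOver


/-! ## §5 (edition 2) The hypothesis-free heads: V3 is ★ `AbelianVariety.subsingleton_ext_one_lineBundle_of_symmetric_isAmple`
(`AbelianVarieties/SymmetricAmpleExtOneVanishing`, B-p05 (g17)) -/

namespace AbelianSchemeOver

section VanishingUnconditional

variable {S : Scheme.{0}} (A : AbelianSchemeOver S) (D : A.DualPair)

/-- **`H¹(A_s̄, ι_s̄^*L^Δ(λ)^{⊗m}) = 0` at every geometric point, unconditionally** (`m ≥ 1`): §3 with the field-level
vanishing for symmetric ample classes supplied by ★ `AbelianVariety.subsingleton_ext_one_lineBundle_of_symmetric_isAmple`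
(the `[n]`-trick, ★ V1 + V2 + V3 + V5). [cite: MumfordFogartyKirwan1994, Ch. 6 §2 Prop. 6.13 (p. 123)]
[cite: MumfordAV1970, §16 (the vanishing theorem)] -/
theorem Polarization.subsingleton_ext_one_restrict_LDelta_tensorPow_of_geometric' (pol : A.Polarization D)
    (Gr : A.X.left ⟶ A.prodLeft D.hat) (hGr₁ : Gr ≫ pullback.fst A.X.hom D.hat.X.hom = 𝟙 _)
    (hGr₂ : Gr ≫ pullback.snd A.X.hom D.hat.X.hom = pol.lam.left)
    {Ω : Type} [Field Ω] [IsAlgClosed Ω] (s : Spec (.of Ω) ⟶ S)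
    {j : (A.fibre s).toAbelianVariety.X.left ⟶ A.X.left} (hι : j = pullback.fst A.X.hom s) {m : ℕ} (hm : 0 < m) :
    Subsingleton (Ext.{1} (unitModule (A.fibre s).toAbelianVariety.X.left)
      ((Scheme.Modules.pullback j).obj (tensorPow ((Scheme.Modules.pullback Gr).obj D.P) m)) 1) :=
  pol.subsingleton_ext_one_restrict_LDelta_tensorPow_of_geometric A D Gr hGr₁ hGr₂ s hι hm
    fun B Θ h₁ h₂ => AbelianVariety.subsingleton_ext_one_lineBundle_of_symmetric_isAmple B Θ h₁ h₂

/-- **`H¹(X₀, L^Δ(λ)^{⊗m}|_{X₀}) = 0` on EVERY fibre of a polarised abelian scheme, unconditionally** (`m ≥ 1`; the (F) consumer's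
`m = 3`): for ANY field `κ`, ANY `t : Spec κ → S` and ANY cartesian square `X₀ = A ×_S Spec κ` — §4 with V3 ★ plugged.  This is the
`hvan` input of ★ `Morphisms/SectionsBaseChangeOfFibreVanishingPoints` ∕ ★ `Modules/PushforwardBaseChangeIsoOfFibreVanishing(GeneralBase)`
and of the H-block of ★ `Morphisms/ProjectiveOverBaseOfFibresEmbedding` at `E = L^Δ(λ)^{⊗3}`, BY NAME.
[cite: MumfordFogartyKirwan1994, Ch. 6 §2 Prop. 6.13 (p. 123)] [cite: MumfordAV1970, §16 (the vanishing theorem)]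
[cite: GortzWedhorn2023, Cor. 22.91 (p. 278)] -/
theorem Polarization.subsingleton_ext_one_pullback_LDelta_tensorPow' (pol : A.Polarization D)
    (Gr : A.X.left ⟶ A.prodLeft D.hat) (hGr₁ : Gr ≫ pullback.fst A.X.hom D.hat.X.hom = 𝟙 _)
    (hGr₂ : Gr ≫ pullback.snd A.X.hom D.hat.X.hom = pol.lam.left)
    {κ : Type} [Field κ] (t : Spec (.of κ) ⟶ S) {X₀ : Scheme.{0}} {iX : X₀ ⟶ A.X.left} {f₀ : X₀ ⟶ Spec (.of κ)}
    (H : IsPullback iX f₀ A.X.hom t) {m : ℕ} (hm : 0 < m) :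
    Subsingleton (Ext.{1} (unitModule X₀)
      ((Scheme.Modules.pullback iX).obj (tensorPow ((Scheme.Modules.pullback Gr).obj D.P) m)) 1) :=
  pol.subsingleton_ext_one_pullback_LDelta_tensorPow A D Gr hGr₁ hGr₂ t H hm
    fun B Θ h₁ h₂ => AbelianVariety.subsingleton_ext_one_lineBundle_of_symmetric_isAmple B Θ h₁ h₂

end VanishingUnconditional

end AbelianSchemeOver

end Literature.AlgebraicGeometry.AbelianSchemes
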